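import Literature.Analysis.SegalBargmann.FockWeightSpaces
import Literature.RingTheory.MvPolynomial.TorusScaling
import HarnessLib

/-!
# The junction with the explicit polynomial models: a one-parameter torus of the Schrödinger model acts on
# `B⁻¹(F · e^{−(π/2)|z|²})` as the torus scaling `X_i ↦ u^{w_i} X_i` of the polynomial `F`

Source followed for the statements: G. B. Folland, *Harmonic Analysis in Phase Space* (1989), (1.78)
(`B⁻¹ F = F(Z^*) h_0`, tree `bargmann_symm_fockToL2`) and Prop. (4.39) (`ν(P) F = F ∘ P⁻¹` on the Fock model, tree
`fockRep_fockToL2`); the polynomial-side torus is `Literature.RingTheory.MvPolynomial.torusAct`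
(tree `TorusScaling`, with the bridge `isWeightedHomogeneous_iff_torusAct` to Mathlib's
`MvPolynomial.IsWeightedHomogeneous`).  Nothing is cited as a fact.

* `linSubst_diagonal_eq_torusAct` — the tree's linear substitution by the diagonal matrix `diag(u^{w_i})` IS
  `torusAct w u`; `star_diagHom_zpow_neg` — for `u ∈ S¹`, `(diagHom (u^{−w}))^* = diag(u^{w})`.
* **`IsRhoCovariant.apply_bargmannSymm_fockToL2`** — for ANY Heisenberg-covariant family `ω` (tree
  `SchrodingerCompactRigidity`) and an element `h` with `ι h = diagHom (fun i => u ^ (−w i))`: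
  `ω h (B⁻¹ (F e^{−(π/2)|z|²})) = vacCoeff ω h • B⁻¹ ((torusAct w u F) e^{−(π/2)|z|²})`.
* `IsRhoCovariant.apply_bargmannSymm_fockToL2_of_isWeightedHomogeneous` — hence a weighted-homogeneous `F` of
  weight `n` gives a weight vector with weight `vacCoeff ω h · u^n`, and conversely
  (`isWeightedHomogeneous_of_weightVector`, from `isWeightedHomogeneous_iff_torusAct` and the injectivity of
  `B⁻¹ ∘ fockToL2`): **the polynomial weights of the explicit models ARE the torus weights of the constructed
  realisation, up to the vacuum character.**
* Dual pair (`FockDualPairCompact`): the centre / scalar torus `u ↦ κW (u, u)` of the second member acts through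
  `ι = diagHom (u^{−blockSignW})` with `blockSignW = +1` on the same-sign blocks and `−1` on the mixed blocks
  (`dpTorus_scalarW_eq_zpow`), so `ω (κW (u,u)) (B⁻¹ F) = vacCoeff • B⁻¹ (torusAct blockSignW u F)`
  (`IsRhoCovariant.apply_κW_scalar_bargmannSymm_fockToL2`) — under `DPIdx (Fin 2) Unit Unit Empty ≃ Fin 2 ⊕ Unit`
  the weight `blockSignW` is the `uW` ("`z_a ↦ +1, w ↦ −1`") of
  `Literature.RepresentationTheory.Ichino2022.ExplicitLineModel`.

## References

* [Folland1989] G. B. Folland, *Harmonic Analysis in Phase Space*, Princeton UP 1989, (1.78) p. 41, Prop. (4.39) p. 161.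
-/

noncomputable section

open MeasureTheory Complex Matrix MvPolynomial
open scoped InnerProductSpace ComplexConjugate

namespace Literature.Analysis.SegalBargmann

open Literature.RingTheory.MvPolynomial (torusAct torusAct_X torusAct_of_isWeightedHomogeneous
  isWeightedHomogeneous_iff_torusAct isWeightedHomogeneous_of_torusAct)

set_option autoImplicit false

/-! ## 1. Diagonal substitution = torus scaling -/

section Torus

variable {σ : Type*} [Fintype σ] [DecidableEq σ]

local notation "L2R" σ => Lp ℂ 2 (volume : Measure (σ → ℝ))

/-- **The linear substitution by `diag(u^{w_i})` is the torus scaling `X_i ↦ u^{w_i} X_i`.** [folklore] -/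
theorem linSubst_diagonal_eq_torusAct (w : σ → ℤ) (u : ℂˣ) :
    linSubst (Matrix.diagonal fun k => ((u ^ w k : ℂˣ) : ℂ)) = torusAct w u := by
  refine MvPolynomial.algHom_ext fun k => ?_
  rw [linSubst_X, torusAct_X, Finset.sum_eq_single k (fun j _ hj => by
    rw [Matrix.diagonal_apply_ne _ (Ne.symm hj), map_zero, zero_mul]) (fun h => (h (Finset.mem_univ k)).elim),
    Matrix.diagonal_apply_eq]

/-- The unit attached to `u ∈ S¹` has value `u`. [folklore] -/
@[simp] theorem coe_toUnits_zpow (u : Circle) (n : ℤ) :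
    ((Circle.toUnits u ^ n : ℂˣ) : ℂ) = ((u : Circle) : ℂ) ^ n := by
  rw [← map_zpow, Circle.toUnits_apply, Units.val_mk0, Circle.coe_zpow]

/-- For `u ∈ S¹`: the adjoint of `diagHom (u^{−w})` is the diagonal matrix `diag(u^{w_i})`. [folklore] -/
theorem star_diagHom_zpow_neg (w : σ → ℤ) (u : Circle) :
    star ((diagHom (fun i => u ^ (-(w i))) : Matrix.unitaryGroup σ ℂ) : Matrix σ σ ℂ) =
      Matrix.diagonal fun k => ((Circle.toUnits u ^ w k : ℂˣ) : ℂ) := by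
  rw [coe_diagHom', Matrix.star_eq_conjTranspose, Matrix.diagonal_conjTranspose]
  congr 1
  funext k
  rw [Pi.star_apply, coe_toUnits_zpow]
  change star (((u ^ (-(w k)) : Circle) : ℂ)) = ((u : Circle) : ℂ) ^ w k
  rw [Complex.star_def, ← Circle.coe_inv_eq_conj, _root_.zpow_neg, inv_inv, Circle.coe_zpow]

/-- **A one-parameter torus of a covariant realisation acts on `B⁻¹(F e^{−(π/2)|z|²})` as the torus scaling of
`F`**, up to the vacuum coefficient. [folklore] -/
theorem IsRhoCovariant.apply_bargmannSymm_fockToL2 {H : Type*} {ι : H → Matrix.unitaryGroup σ ℂ}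
    {ω : H → ((L2R σ) ≃ₗᵢ[ℂ] (L2R σ))} (hω : IsRhoCovariant ι ω) {h : H} {w : σ → ℤ} {u : Circle}
    (hh : ι h = diagHom fun i => u ^ (-(w i))) (F : MvPolynomial σ ℂ) :
    ω h (bargmann.symm (fockToL2 F)) =
      vacCoeff ω h • bargmann.symm (fockToL2 (torusAct w (Circle.toUnits u) F)) := by
  rw [hω.apply, schrodingerU_apply, LinearIsometryEquiv.apply_symm_apply, fockRep_fockToL2, hh,
    star_diagHom_zpow_neg, linSubst_diagonal_eq_torusAct]

/-- Weighted-homogeneous polynomials give weight vectors: weight `vacCoeff ω h · u^n`. [folklore] -/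
theorem IsRhoCovariant.apply_bargmannSymm_fockToL2_of_isWeightedHomogeneous {H : Type*}
    {ι : H → Matrix.unitaryGroup σ ℂ} {ω : H → ((L2R σ) ≃ₗᵢ[ℂ] (L2R σ))} (hω : IsRhoCovariant ι ω) {h : H}
    {w : σ → ℤ} {u : Circle} (hh : ι h = diagHom fun i => u ^ (-(w i))) {F : MvPolynomial σ ℂ} {n : ℤ}
    (hF : IsWeightedHomogeneous w F n) :
    ω h (bargmann.symm (fockToL2 F)) = (vacCoeff ω h * ((u : Circle) : ℂ) ^ n) • bargmann.symm (fockToL2 F) := by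
  rw [hω.apply_bargmannSymm_fockToL2 hh, torusAct_of_isWeightedHomogeneous w _ hF, map_smul, map_smul, smul_smul,
    coe_toUnits_zpow]

/-- `B⁻¹ ∘ fockToL2` is injective. [folklore] -/
theorem bargmannSymm_fockToL2_injective :
    Function.Injective fun F : MvPolynomial σ ℂ => (bargmann (σ := σ)).symm (fockToL2 F) :=
  fun _ _ h => fockToL2_injective ((bargmann (σ := σ)).symm.injective h)

/-- **Conversely**: if along a one-parameter torus `u ↦ h u` with `ι (h u) = diagHom (u^{−w})` the vector
`B⁻¹(F e^{−(π/2)|z|²})` has weight `vacCoeff ω (h u) · u^n` for every `u ∈ S¹`, then `F` is weighted-homogeneous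
of weight `n` (the bridge `isWeightedHomogeneous_iff_torusAct`). [folklore] -/
theorem IsRhoCovariant.isWeightedHomogeneous_of_weightVector {H : Type*} {ι : H → Matrix.unitaryGroup σ ℂ}
    {ω : H → ((L2R σ) ≃ₗᵢ[ℂ] (L2R σ))} (hω : IsRhoCovariant ι ω) {h : Circle → H} {w : σ → ℤ}
    (hh : ∀ u, ι (h u) = diagHom fun i => u ^ (-(w i))) {F : MvPolynomial σ ℂ} {n : ℤ}
    (hF : ∀ u : Circle, ω (h u) (bargmann.symm (fockToL2 F)) =
      (vacCoeff ω (h u) * ((u : Circle) : ℂ) ^ n) • bargmann.symm (fockToL2 F)) :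
    IsWeightedHomogeneous w F n := by
  refine isWeightedHomogeneous_of_torusAct w fun v hv => ?_
  set u : Circle := ⟨(v : ℂ), mem_sphere_zero_iff_norm.2 hv⟩ with hu
  have huv : Circle.toUnits u = v := Units.ext rfl
  have key := hF u
  rw [hω.apply_bargmannSymm_fockToL2 (hh u), ← smul_smul] at key
  have hc : vacCoeff ω (h u) ≠ 0 := fun h0 => by
    have := hω.norm_vacCoeff (h u); rw [h0, norm_zero] at this; exact zero_ne_one this
  have key' := smul_right_injective (L2R σ) hc key
  rw [← map_smul, ← map_smul] at key'
  have := bargmannSymm_fockToL2_injective key'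
  rw [huv] at this
  rw [this, ← huv, coe_toUnits_zpow]

end Torus

/-! ## 2. The dual pair: the scalar torus of the second member -/

section DualPair

variable {P Q R S : Type*} [Fintype P] [DecidableEq P] [Fintype Q] [DecidableEq Q] [Fintype R] [DecidableEq R]
  [Fintype S] [DecidableEq S]

local notation "L2R" σ => Lp ℂ 2 (volume : Measure (σ → ℝ))

omit [Fintype P] [DecidableEq P] [Fintype Q] [DecidableEq Q] [Fintype R] [DecidableEq R] [Fintype S]
  [DecidableEq S] in
/-- **The block sign weight** of the second member's centre: `+1` on the same-sign blocks `P×R`, `Q×S`, `−1` on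
the mixed blocks `P×S`, `Q×R` (the `uW` of the explicit line model). [folklore] -/
def blockSignW : DPIdx P Q R S → ℤ
  | Sum.inl _ => 1
  | Sum.inr _ => -1

omit [Fintype P] [DecidableEq P] [Fintype Q] [DecidableEq Q] [Fintype R] [DecidableEq R] [Fintype S]
  [DecidableEq S] in
/-- The torus datum of the scalar `u ∈ Z(U(W))`: `dpTorus 1 1 u u = u^{−blockSignW}`. [folklore] -/
theorem dpTorus_scalarW_eq_zpow (u : Circle) :
    dpTorus (fun _ : P => (1 : Circle)) (fun _ : Q => (1 : Circle)) (fun _ : R => u) (fun _ : S => u) =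
      fun l => u ^ (-(blockSignW l)) := by
  funext l
  rcases l with ((⟨p, r⟩ | ⟨q, s⟩) | (⟨p, s⟩ | ⟨q, r⟩)) <;>
    simp [dpTorus, blockSignW, one_mul]

/-- `ι (κW (u, u)) = diagHom (u^{−blockSignW})`. [folklore] -/
theorem dualPairι_κW_scalar (u : Circle) :
    dualPairι (κW (P := P) (Q := Q) ((fun _ : R => u), (fun _ : S => u))) =
      diagHom fun l : DPIdx P Q R S => u ^ (-(blockSignW l)) := by
  rw [dualPairι_κW, τW, dpTorus_scalarW_eq_zpow]

/-- **The centre of `U(W)` on the constructed model = the `uW`-torus scaling of the explicit model**: for any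
Heisenberg-covariant realisation `ω` of the compact dual pair,
`ω (κW (u,u)) (B⁻¹ (F e^{−(π/2)|z|²})) = vacCoeff • B⁻¹ ((torusAct blockSignW u F) e^{−(π/2)|z|²})`. [folklore] -/
theorem IsRhoCovariant.apply_κW_scalar_bargmannSymm_fockToL2
    {ω : DPK P Q R S → ((L2R (DPIdx P Q R S)) ≃ₗᵢ[ℂ] (L2R (DPIdx P Q R S)))}
    (hω : IsRhoCovariant (fun k => dualPairι k) ω) (u : Circle) (F : MvPolynomial (DPIdx P Q R S) ℂ) :
    ω (κW ((fun _ : R => u), (fun _ : S => u))) (bargmann.symm (fockToL2 F)) =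
      vacCoeff ω (κW ((fun _ : R => u), (fun _ : S => u))) •
        bargmann.symm (fockToL2 (torusAct blockSignW (Circle.toUnits u) F)) :=
  hω.apply_bargmannSymm_fockToL2 (dualPairι_κW_scalar u) F

/-- **`uW`-homogeneous polynomials of weight `n` are `Z(U(W))`-weight vectors of weight `vacCoeff · u^n`, and
conversely.** [folklore] -/
theorem IsRhoCovariant.isWeightedHomogeneous_blockSignW_iff
    {ω : DPK P Q R S → ((L2R (DPIdx P Q R S)) ≃ₗᵢ[ℂ] (L2R (DPIdx P Q R S)))}
    (hω : IsRhoCovariant (fun k => dualPairι k) ω) (F : MvPolynomial (DPIdx P Q R S) ℂ) (n : ℤ) :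
    IsWeightedHomogeneous blockSignW F n ↔
      ∀ u : Circle, ω (κW ((fun _ : R => u), (fun _ : S => u))) (bargmann.symm (fockToL2 F)) =
        (vacCoeff ω (κW ((fun _ : R => u), (fun _ : S => u))) * ((u : Circle) : ℂ) ^ n) •
          bargmann.symm (fockToL2 F) :=
  ⟨fun hF u => hω.apply_bargmannSymm_fockToL2_of_isWeightedHomogeneous (dualPairι_κW_scalar u) hF,
    fun hF => hω.isWeightedHomogeneous_of_weightVector
      (h := fun u : Circle => κW (P := P) (Q := Q) ((fun _ : R => u), (fun _ : S => u)))
      (fun u => dualPairι_κW_scalar u) hF⟩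

end DualPair

end Literature.Analysis.SegalBargmann
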